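import Summits.ABC.IUTFork.Repair.RHTameBandLicenceSigmaAbc
import Summits.ABC.IUTFork.Repair.RHTameBandLicenceSigmaBall
import HarnessLib

/-!
# R-H ROUND 2, Q2(5) PER DATUM: «R_{Σ₅}(T) ≤ Tol(P,l)» and the hull estimate AT THAT DATUM give [IUTchIV] Thm. 1.10's display at `(P, l)` —
# the row-5 tolerance quantified PER DATUM CLASS (no `∀ T` binder, no cone binder), for Σ₅ and for the ball scope Σ₅♭

Seat abc-iut-rh-typ-5 (R-H PAIR n = 5 TYPER, gen 4). PROOF-ONLY sequel (0 definitions, nothing re-typed) of this seat's `RHTameBandLicenceSigmaAbc`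
(p472385) and `RHTameBandLicenceSigmaBall` (p473920), composing BY NAME rh2-q2-cond's hreg-FREE arithmetic `Conditional.Cor312Slack.logQAvoid_le_of_cor312Slack`
/ `display_of_squeezeIII_slack'` (p469667 §1–§2; rh-lead R14 (2): «the no-loss arithmetic is untouched»).

WHY (abc-iut-rh-tst-5 g3 2026-08-26T23:45:56Z, tester addendum on the endpoint `abc_of_offRemainder_sigmaFive_le_tol`; rh-lead g2 RULING R14 23:54:09Z).
The gen-3 endpoint takes [TOL] as «∀ admissible (P, l, T): R_{Σ₅}(T) ≤ Tol(P,l)» and the blanket cone binder `hreg`. The tester's point: in the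
intended arithmetic the ∀-quantified [TOL] has no model (Σ₅ omits every bad odd prime `p < l + 2` wholesale, e.g. the family `(1, 7ⁿ−1, 7ⁿ)` at
`l = 11`), and R14 books `hreg` as kernel-refuted (`Conditional.not_hreg_v4`) — so the ∀-form certifies nothing beyond its composition record.
THE REPAIR TYPED HERE is the tester's: quantify PER DATUM. At ONE genuine Θ-volume datum `T` of an admissible-or-not `(P, l)` (`λ ∈ U_X`,
`l ≥ 7` prime), the two inequalities AT THAT DATUM —
  [TOL]_T  `R_{Σ₅}(T) ≤ ((l+1)/4)·5·(2¹²·3³·5·d_mod)·l`  (a bound on a DEFINED number: the off-Σ₅ remainder of OUR typed hull at the chosen ideles),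
  [HULL]_T `T.HullEstimateOf(B_III(P,l))`  (the hull estimate with print's constant at `T` — what the cone binder used to supply per datum),
— give print's display `Cor22.Display P l η_prm` for every `η_prm` of Prop. 1.6, constants UNCHANGED; the Cor. 3.12 side is the THEOREM
`cor312UpTo_sigmaFive_chosen` (NO S_H, NO H⋆₅, licence on Σ₅ PROVED). So the datum class on which row 5 delivers Thm. 1.10 is EXACTLY
`{T : [TOL]_T ∧ [HULL]_T}` — named, not hidden behind a false universal; abc needs, in addition, an INDEPENDENT treatment of the complementary class
(deep bad primes: R-W / the window certificates with `hNum`), which this file does not claim.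
RESULTS (namespace `Summit.ABC.IUTFork.Repair.RH.TameBandLicenceSigmaAbc`):
* `display_of_offRemainder_sigmaFive_le_tol_at` — [TOL]_T ∧ [HULL]_T ⟹ `Cor22.Display P l η` (Σ₅);
* `cor312UpTo_sigmaFiveBall_chosen` — «Cor. 3.12 up to `R_{Σ₅♭}`» at `T` and the chosen realising ideles (the ball scope's datum-level theorem,
  from p473920's `GenuineK.cor312UpTo_sigmaFiveBall`; NO S_H);
* `display_of_offRemainder_sigmaFiveBall_le_tol_at` — the same display from the WEAKER binder [TOL♭]_T `R_{Σ₅♭}(T) ≤ Tol` (`R_{Σ₅♭} ≤ R_{Σ₅}`).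
* By rh2-q2-eq's invariance (`RHSigmaStrataEqInvariance.offRemainder_sigmaFive_eq_offRemainder_empty`, gen 2) `R_{Σ₅}(T) = R_{Σ₅♭}(T) = R_∅(T)`
  (the total positive cell deficit): every [TOL] here is a bound on ONE number; the R14 recut of the ∀-form abc-end is the sequel `RHTameBandLicenceSigmaAbcRecut`.
HONEST FRAMING: CONDITIONAL per datum on the two named inequalities; nothing here asserts that abc is proved or refuted, that [TOL]_T or [HULL]_T
holds at any datum, or that [IUTchIII] Cor. 3.12 holds or fails anywhere; no side taken on any author (Mochizuki / Scholze–Stix / Joshi /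
Dupuy–Hilado); typed ≠ proved; instantiated ≠ endorsed. [cite: Mochizuki2012, IUTchIII Cor. 3.12 p. 173–174; IUTchIV Thm. 1.10 Steps (vii)–(viii)
pp. 30–31, Prop. 1.6 p. 16] [cite: DupuyHilado2025, §3.3, §3.4] [claim: Mochizuki2012, status: disputed] for every IUT sentence quoted. Axioms: standard.
-/

noncomputable section

open Set Function NumberField IsDedekindDomain
open scoped Pointwise

namespace Summit.ABC.IUTFork.Repair.RH.TameBandLicenceSigmaAbc

open Summit.ABC.IUTFork.Thm311 Summit.ABC.IUTFork.Thm311.Real Summit.ABC.IUTFork.Cor312 Summit.ABC.IUTFork.Cor312.Setting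
  Summit.ABC.IUTFork.Cor312Vol Summit.ABC.IUTFork.Cor312Prov Literature.IUT.LogThetaLattice Literature.IUT.LogVolume
  Literature.IUT.HodgeTheaters Literature.IUT.LogVolume.ThetaData
  Literature.NumberTheory.DiophantineGeometry.GenEll Summit.ABC.ABC.Theorems
  Summit.ABC.IUTFork.Repair.RH.SigmaLicence Summit.ABC.IUTFork.Repair.RH.SigmaStrataEq Summit.ABC.IUTFork.Repair.RH
  Summit.ABC.IUTFork.Conditional

/-! ## §1. Σ₅: the display at ONE datum from [TOL]_T and [HULL]_T -/

/-- **Row 5 PER DATUM**: at a genuine Θ-volume datum `T` of `(P, l)` with `λ ∈ U_X`, `l ≥ 5` prime, `l ≠ 5`, and every `η_prm` of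
Prop. 1.6: IF the off-Σ₅ remainder of OUR typed hull at the chosen realising ideles is within the tolerance, [TOL]_T, AND the hull estimate with
`B_III(P,l)` holds at `T`, [HULL]_T, THEN print's display `Cor22.Display P l η_prm` (constants unchanged). The Cor. 3.12 side is the theorem
`cor312UpTo_sigmaFive_chosen`; the arithmetic is rh2-q2-cond's `logQAvoid_le_of_cor312Slack` ∘ `display_of_squeezeIII_slack'`. No `∀ T` binder,
no cone binder. CONDITIONAL per datum; no side taken. [cite: Mochizuki2012, IUTchIV Thm. 1.10 Steps (vii)–(viii) p. 30–31]
[claim: Mochizuki2012, status: disputed] -/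
theorem display_of_offRemainder_sigmaFive_le_tol_at {P : NFPoint} {l : ℕ} (T : Cor22.ThetaVolumeDatumAt P l) (hU : P.InU)
    (hl : l.Prime) (h5 : 5 ≤ l) (hne : l ≠ 5) {η : ℝ} (hη : IsEtaPrm η) :
    letI := T.instFieldF; letI := T.instNumberFieldF; letI := T.instAlgebraF; letI := T.instFieldK;
        letI := T.instNumberFieldK; letI := T.instAlgebraK; letI := T.instFieldFbar; letI := T.instAlgebraFbar;
        letI := T.instAlgebraKFbar; letI := T.instIsElliptic;
    ∀ (M : Type) [Field M] [NumberField M]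
      (archPk : ∀ (j : (thetaIndex (pilotDataOfK T.D T.K)).Label) (vQ : (thetaIndex (pilotDataOfK T.D T.K)).VQ),
        Set ((logShellsDH (pilotDataOfK T.D T.K) (analyticLogv T.K)).Packet j vQ))
      (archSub : ∀ (j : (thetaIndex (pilotDataOfK T.D T.K)).Label) (v : (thetaIndex (pilotDataOfK T.D T.K)).V),
        Set ((logShellsDH (pilotDataOfK T.D T.K) (analyticLogv T.K)).Packet j ((thetaIndex (pilotDataOfK T.D T.K)).over v)))
      (Ψ : ℤ → ∀ v : (thetaIndex (pilotDataOfK T.D T.K)).V, v ∈ (thetaIndex (pilotDataOfK T.D T.K)).Vbad →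
        Set ((logShellsDH (pilotDataOfK T.D T.K) (analyticLogv T.K)).StarPacket v))
      (act : ℤ → ∀ v : (thetaIndex (pilotDataOfK T.D T.K)).V, v ∈ (thetaIndex (pilotDataOfK T.D T.K)).Vbad →
        (logShellsDH (pilotDataOfK T.D T.K) (analyticLogv T.K)).StarPacket v →
          Module.End ℚ ((logShellsDH (pilotDataOfK T.D T.K) (analyticLogv T.K)).StarPacket v))
      (Mmod : ℤ → ∀ j : (thetaIndex (pilotDataOfK T.D T.K)).LabelStar,
        Set ((logShellsDH (pilotDataOfK T.D T.K) (analyticLogv T.K)).GlobalPacket j.1))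
      (region : ℤ → ∀ j : (thetaIndex (pilotDataOfK T.D T.K)).LabelStar, FinDivisor M →
        ∀ vQ : (thetaIndex (pilotDataOfK T.D T.K)).VQ, Set ((logShellsDH (pilotDataOfK T.D T.K) (analyticLogv T.K)).Packet j.1 vQ))
      (n : ℤ) {HT : Type} {LogLink : HT → HT → Type} {IsFull : ∀ {s t : HT}, LogLink s t → Prop}
      (lat : LGPGaussianLogThetaLattice LogLink IsFull)
      {Frd : Type} {IsoF : Frd → Frd → Type} {Ob : Frd → Type} {realify : Frd → Frd} {Strip : Type}
      {IsoS : Strip → Strip → Type}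
      {Mv : ∀ v : (thetaIndex (pilotDataOfK T.D T.K)).V, v ∈ (thetaIndex (pilotDataOfK T.D T.K)).Vbad → Type}
      [∀ v h, Monoid (Mv v h)]
      (sig : GlobalLGPFrobenioidSignature (thetaIndex (pilotDataOfK T.D T.K)).lstar (thetaIndex (pilotDataOfK T.D T.K)).V
        (· ∈ (thetaIndex (pilotDataOfK T.D T.K)).Vbad) Frd IsoF Ob realify Strip IsoS Mv)
      (split : SplittingMonoids Mv) {ObΔ : Type}
      {N : ∀ v : (thetaIndex (pilotDataOfK T.D T.K)).V, v ∈ (thetaIndex (pilotDataOfK T.D T.K)).Vbad → Type} [∀ v h, Monoid (N v h)]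
      (qData : QPilotData ObΔ N),
      offRemainder
          (settingPrVolSharp (pilotDataOfK T.D T.K) (logvAnalytic_analyticLogv (F := T.K)) M archPk archSub Ψ act Mmod region n lat
            sig split qData (exists_realising_qIdeles_pilotDataOfK T.D).choose (exists_realising_thetaIdeles_pilotDataOfK T.D).choose
            (exists_realising_qIdeles_pilotDataOfK T.D).choose_spec.1 (exists_realising_qIdeles_pilotDataOfK T.D).choose_spec.2.1)
          (TameBandLicenceSigma.sigmaFive T.D) ≤
          ((l : ℝ) + 1) / 4 * (5 * ((((2 ^ 12 * 3 ^ 3 * 5 * Cor22.dmod P : ℕ) : ℝ)) * l)) →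
        T.HullEstimateOf
          (((l : ℝ) + 1) / 4 *
            ((1 + 12 * (Cor22.dmod P : ℝ) / l) * (P.logDiff + Cor22.logCondAvoid P {2, l})
              + 2 * Real.log l + 52
              + 20 / 3 * Real.log (((2 ^ 12 * 3 ^ 3 * 5 * Cor22.dmod P : ℕ) : ℝ) * (l : ℝ))
                * (Nat.primeCounting (2 ^ 12 * 3 ^ 3 * 5 * Cor22.dmod P * l) : ℝ))) →
        Cor22.Display P l η := by
  intro M _ _ archPk archSub Ψ act Mmod region n HT LogLink IsFull lat Frd IsoF Ob realify Strip IsoS Mv _ sig split ObΔ N _ qData hTolT hHullT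
  letI := T.instFieldF; letI := T.instNumberFieldF; letI := T.instAlgebraF; letI := T.instFieldK
  letI := T.instNumberFieldK; letI := T.instAlgebraK; letI := T.instFieldFbar; letI := T.instAlgebraFbar
  letI := T.instAlgebraKFbar; letI := T.instIsElliptic
  exact Cor312Slack.display_of_squeezeIII_slack' hl h5 hne hη hTolT
    (Cor312Slack.logQAvoid_le_of_cor312Slack T hU
      (cor312UpTo_sigmaFive_chosen T M archPk archSub Ψ act Mmod region n lat sig split qData) hHullT)

/-! ## §2. The ball scope Σ₅♭ ⊇ Σ₅: Cor. 3.12 up to `R_{Σ₅♭}` at the chosen ideles, and the display per datum -/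

/-- **At a genuine Θ-volume datum `T` of `(P, l)` and the CHOSEN realising ideles**: `−|log(q)|(T) ≤ −|log(Θ)|(T) + R_{Σ₅♭}(T)` — the
TAME/BALL scope of row 5 (this seat's `TameBandLicenceSigmaBall.GenuineK.cor312UpTo_sigmaFiveBall`, p473920) at the chosen ideles; NO S_H,
NO H⋆, no admissibility guard. [claim: Mochizuki2012, status: disputed] -/
theorem cor312UpTo_sigmaFiveBall_chosen {P : NFPoint} {l : ℕ} (T : Cor22.ThetaVolumeDatumAt P l) :
    letI := T.instFieldF; letI := T.instNumberFieldF; letI := T.instAlgebraF; letI := T.instFieldK;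
        letI := T.instNumberFieldK; letI := T.instAlgebraK; letI := T.instFieldFbar; letI := T.instAlgebraFbar;
        letI := T.instAlgebraKFbar; letI := T.instIsElliptic;
    ∀ (M : Type) [Field M] [NumberField M]
      (archPk : ∀ (j : (thetaIndex (pilotDataOfK T.D T.K)).Label) (vQ : (thetaIndex (pilotDataOfK T.D T.K)).VQ),
        Set ((logShellsDH (pilotDataOfK T.D T.K) (analyticLogv T.K)).Packet j vQ))
      (archSub : ∀ (j : (thetaIndex (pilotDataOfK T.D T.K)).Label) (v : (thetaIndex (pilotDataOfK T.D T.K)).V),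
        Set ((logShellsDH (pilotDataOfK T.D T.K) (analyticLogv T.K)).Packet j ((thetaIndex (pilotDataOfK T.D T.K)).over v)))
      (Ψ : ℤ → ∀ v : (thetaIndex (pilotDataOfK T.D T.K)).V, v ∈ (thetaIndex (pilotDataOfK T.D T.K)).Vbad →
        Set ((logShellsDH (pilotDataOfK T.D T.K) (analyticLogv T.K)).StarPacket v))
      (act : ℤ → ∀ v : (thetaIndex (pilotDataOfK T.D T.K)).V, v ∈ (thetaIndex (pilotDataOfK T.D T.K)).Vbad →
        (logShellsDH (pilotDataOfK T.D T.K) (analyticLogv T.K)).StarPacket v →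
          Module.End ℚ ((logShellsDH (pilotDataOfK T.D T.K) (analyticLogv T.K)).StarPacket v))
      (Mmod : ℤ → ∀ j : (thetaIndex (pilotDataOfK T.D T.K)).LabelStar,
        Set ((logShellsDH (pilotDataOfK T.D T.K) (analyticLogv T.K)).GlobalPacket j.1))
      (region : ℤ → ∀ j : (thetaIndex (pilotDataOfK T.D T.K)).LabelStar, FinDivisor M →
        ∀ vQ : (thetaIndex (pilotDataOfK T.D T.K)).VQ, Set ((logShellsDH (pilotDataOfK T.D T.K) (analyticLogv T.K)).Packet j.1 vQ))
      (n : ℤ) {HT : Type} {LogLink : HT → HT → Type} {IsFull : ∀ {s t : HT}, LogLink s t → Prop}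
      (lat : LGPGaussianLogThetaLattice LogLink IsFull)
      {Frd : Type} {IsoF : Frd → Frd → Type} {Ob : Frd → Type} {realify : Frd → Frd} {Strip : Type}
      {IsoS : Strip → Strip → Type}
      {Mv : ∀ v : (thetaIndex (pilotDataOfK T.D T.K)).V, v ∈ (thetaIndex (pilotDataOfK T.D T.K)).Vbad → Type}
      [∀ v h, Monoid (Mv v h)]
      (sig : GlobalLGPFrobenioidSignature (thetaIndex (pilotDataOfK T.D T.K)).lstar (thetaIndex (pilotDataOfK T.D T.K)).V
        (· ∈ (thetaIndex (pilotDataOfK T.D T.K)).Vbad) Frd IsoF Ob realify Strip IsoS Mv)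
      (split : SplittingMonoids Mv) {ObΔ : Type}
      {N : ∀ v : (thetaIndex (pilotDataOfK T.D T.K)).V, v ∈ (thetaIndex (pilotDataOfK T.D T.K)).Vbad → Type} [∀ v h, Monoid (N v h)]
      (qData : QPilotData ObΔ N),
      T.negAbsLogQ ≤ T.negLogTheta +
        offRemainder
          (settingPrVolSharp (pilotDataOfK T.D T.K) (logvAnalytic_analyticLogv (F := T.K)) M archPk archSub Ψ act Mmod region n lat
            sig split qData (exists_realising_qIdeles_pilotDataOfK T.D).choose (exists_realising_thetaIdeles_pilotDataOfK T.D).choose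
            (exists_realising_qIdeles_pilotDataOfK T.D).choose_spec.1 (exists_realising_qIdeles_pilotDataOfK T.D).choose_spec.2.1)
          (TameBandLicenceSigmaBall.sigmaFiveBall T.D) := by
  intro M _ _ archPk archSub Ψ act Mmod region n HT LogLink IsFull lat Frd IsoF Ob realify Strip IsoS Mv _ sig split ObΔ N _ qData
  letI := T.instFieldF; letI := T.instNumberFieldF; letI := T.instAlgebraF; letI := T.instFieldK
  letI := T.instNumberFieldK; letI := T.instAlgebraK; letI := T.instFieldFbar; letI := T.instAlgebraFbar
  letI := T.instAlgebraKFbar; letI := T.instIsElliptic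
  exact TameBandLicenceSigmaBall.GenuineK.cor312UpTo_sigmaFiveBall T.D M archPk archSub Ψ act Mmod region n lat sig split qData
    (exists_realising_qIdeles_pilotDataOfK T.D).choose (exists_realising_thetaIdeles_pilotDataOfK T.D).choose
    (exists_realising_qIdeles_pilotDataOfK T.D).choose_spec.1 (exists_realising_qIdeles_pilotDataOfK T.D).choose_spec.2.1
    T.isVolumeInputOf (exists_realising_thetaIdeles_pilotDataOfK T.D).choose_spec.1
    (exists_realising_thetaIdeles_pilotDataOfK T.D).choose_spec.2.1 (exists_realising_qIdeles_pilotDataOfK T.D).choose_spec.2.2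
    (exists_realising_thetaIdeles_pilotDataOfK T.D).choose_spec.2.2


/-- **Row 5, ball scope, PER DATUM**: [TOL♭]_T `R_{Σ₅♭}(T) ≤ ((l+1)/4)·5·(2¹²·3³·5·d_mod)·l` (WEAKER than [TOL]_T since `R_{Σ₅♭} ≤ R_{Σ₅}`,
`offRemainder_sigmaFiveBall_le_sigmaFive`) and [HULL]_T give `Cor22.Display P l η_prm`. CONDITIONAL per datum; no side taken.
[cite: Mochizuki2012, IUTchIV Thm. 1.10 Steps (vii)–(viii) p. 30–31] [claim: Mochizuki2012, status: disputed] -/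
theorem display_of_offRemainder_sigmaFiveBall_le_tol_at {P : NFPoint} {l : ℕ} (T : Cor22.ThetaVolumeDatumAt P l) (hU : P.InU)
    (hl : l.Prime) (h5 : 5 ≤ l) (hne : l ≠ 5) {η : ℝ} (hη : IsEtaPrm η) :
    letI := T.instFieldF; letI := T.instNumberFieldF; letI := T.instAlgebraF; letI := T.instFieldK;
        letI := T.instNumberFieldK; letI := T.instAlgebraK; letI := T.instFieldFbar; letI := T.instAlgebraFbar;
        letI := T.instAlgebraKFbar; letI := T.instIsElliptic;
    ∀ (M : Type) [Field M] [NumberField M]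
      (archPk : ∀ (j : (thetaIndex (pilotDataOfK T.D T.K)).Label) (vQ : (thetaIndex (pilotDataOfK T.D T.K)).VQ),
        Set ((logShellsDH (pilotDataOfK T.D T.K) (analyticLogv T.K)).Packet j vQ))
      (archSub : ∀ (j : (thetaIndex (pilotDataOfK T.D T.K)).Label) (v : (thetaIndex (pilotDataOfK T.D T.K)).V),
        Set ((logShellsDH (pilotDataOfK T.D T.K) (analyticLogv T.K)).Packet j ((thetaIndex (pilotDataOfK T.D T.K)).over v)))
      (Ψ : ℤ → ∀ v : (thetaIndex (pilotDataOfK T.D T.K)).V, v ∈ (thetaIndex (pilotDataOfK T.D T.K)).Vbad →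
        Set ((logShellsDH (pilotDataOfK T.D T.K) (analyticLogv T.K)).StarPacket v))
      (act : ℤ → ∀ v : (thetaIndex (pilotDataOfK T.D T.K)).V, v ∈ (thetaIndex (pilotDataOfK T.D T.K)).Vbad →
        (logShellsDH (pilotDataOfK T.D T.K) (analyticLogv T.K)).StarPacket v →
          Module.End ℚ ((logShellsDH (pilotDataOfK T.D T.K) (analyticLogv T.K)).StarPacket v))
      (Mmod : ℤ → ∀ j : (thetaIndex (pilotDataOfK T.D T.K)).LabelStar,
        Set ((logShellsDH (pilotDataOfK T.D T.K) (analyticLogv T.K)).GlobalPacket j.1))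
      (region : ℤ → ∀ j : (thetaIndex (pilotDataOfK T.D T.K)).LabelStar, FinDivisor M →
        ∀ vQ : (thetaIndex (pilotDataOfK T.D T.K)).VQ, Set ((logShellsDH (pilotDataOfK T.D T.K) (analyticLogv T.K)).Packet j.1 vQ))
      (n : ℤ) {HT : Type} {LogLink : HT → HT → Type} {IsFull : ∀ {s t : HT}, LogLink s t → Prop}
      (lat : LGPGaussianLogThetaLattice LogLink IsFull)
      {Frd : Type} {IsoF : Frd → Frd → Type} {Ob : Frd → Type} {realify : Frd → Frd} {Strip : Type}
      {IsoS : Strip → Strip → Type}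
      {Mv : ∀ v : (thetaIndex (pilotDataOfK T.D T.K)).V, v ∈ (thetaIndex (pilotDataOfK T.D T.K)).Vbad → Type}
      [∀ v h, Monoid (Mv v h)]
      (sig : GlobalLGPFrobenioidSignature (thetaIndex (pilotDataOfK T.D T.K)).lstar (thetaIndex (pilotDataOfK T.D T.K)).V
        (· ∈ (thetaIndex (pilotDataOfK T.D T.K)).Vbad) Frd IsoF Ob realify Strip IsoS Mv)
      (split : SplittingMonoids Mv) {ObΔ : Type}
      {N : ∀ v : (thetaIndex (pilotDataOfK T.D T.K)).V, v ∈ (thetaIndex (pilotDataOfK T.D T.K)).Vbad → Type} [∀ v h, Monoid (N v h)]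
      (qData : QPilotData ObΔ N),
      offRemainder
          (settingPrVolSharp (pilotDataOfK T.D T.K) (logvAnalytic_analyticLogv (F := T.K)) M archPk archSub Ψ act Mmod region n lat
            sig split qData (exists_realising_qIdeles_pilotDataOfK T.D).choose (exists_realising_thetaIdeles_pilotDataOfK T.D).choose
            (exists_realising_qIdeles_pilotDataOfK T.D).choose_spec.1 (exists_realising_qIdeles_pilotDataOfK T.D).choose_spec.2.1)
          (TameBandLicenceSigmaBall.sigmaFiveBall T.D) ≤
          ((l : ℝ) + 1) / 4 * (5 * ((((2 ^ 12 * 3 ^ 3 * 5 * Cor22.dmod P : ℕ) : ℝ)) * l)) →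
        T.HullEstimateOf
          (((l : ℝ) + 1) / 4 *
            ((1 + 12 * (Cor22.dmod P : ℝ) / l) * (P.logDiff + Cor22.logCondAvoid P {2, l})
              + 2 * Real.log l + 52
              + 20 / 3 * Real.log (((2 ^ 12 * 3 ^ 3 * 5 * Cor22.dmod P : ℕ) : ℝ) * (l : ℝ))
                * (Nat.primeCounting (2 ^ 12 * 3 ^ 3 * 5 * Cor22.dmod P * l) : ℝ))) →
        Cor22.Display P l η := by
  intro M _ _ archPk archSub Ψ act Mmod region n HT LogLink IsFull lat Frd IsoF Ob realify Strip IsoS Mv _ sig split ObΔ N _ qData hTolT hHullT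
  letI := T.instFieldF; letI := T.instNumberFieldF; letI := T.instAlgebraF; letI := T.instFieldK
  letI := T.instNumberFieldK; letI := T.instAlgebraK; letI := T.instFieldFbar; letI := T.instAlgebraFbar
  letI := T.instAlgebraKFbar; letI := T.instIsElliptic
  exact Cor312Slack.display_of_squeezeIII_slack' hl h5 hne hη hTolT
    (Cor312Slack.logQAvoid_le_of_cor312Slack T hU
      (cor312UpTo_sigmaFiveBall_chosen T M archPk archSub Ψ act Mmod region n lat sig split qData) hHullT)

/-- **The Σ₅ tolerance implies the Σ₅♭ tolerance at every datum** (`R_{Σ₅♭} ≤ R_{Σ₅}`): the ball-scope display theorem is the stronger one.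
[claim: Mochizuki2012, status: disputed] -/
theorem offRemainder_sigmaFiveBall_le_tol_of_sigmaFive {P : NFPoint} {l : ℕ} (T : Cor22.ThetaVolumeDatumAt P l) :
    letI := T.instFieldF; letI := T.instNumberFieldF; letI := T.instAlgebraF; letI := T.instFieldK;
        letI := T.instNumberFieldK; letI := T.instAlgebraK; letI := T.instFieldFbar; letI := T.instAlgebraFbar;
        letI := T.instAlgebraKFbar; letI := T.instIsElliptic;
    ∀ (M : Type) [Field M] [NumberField M]
      (archPk : ∀ (j : (thetaIndex (pilotDataOfK T.D T.K)).Label) (vQ : (thetaIndex (pilotDataOfK T.D T.K)).VQ),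
        Set ((logShellsDH (pilotDataOfK T.D T.K) (analyticLogv T.K)).Packet j vQ))
      (archSub : ∀ (j : (thetaIndex (pilotDataOfK T.D T.K)).Label) (v : (thetaIndex (pilotDataOfK T.D T.K)).V),
        Set ((logShellsDH (pilotDataOfK T.D T.K) (analyticLogv T.K)).Packet j ((thetaIndex (pilotDataOfK T.D T.K)).over v)))
      (Ψ : ℤ → ∀ v : (thetaIndex (pilotDataOfK T.D T.K)).V, v ∈ (thetaIndex (pilotDataOfK T.D T.K)).Vbad →
        Set ((logShellsDH (pilotDataOfK T.D T.K) (analyticLogv T.K)).StarPacket v))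
      (act : ℤ → ∀ v : (thetaIndex (pilotDataOfK T.D T.K)).V, v ∈ (thetaIndex (pilotDataOfK T.D T.K)).Vbad →
        (logShellsDH (pilotDataOfK T.D T.K) (analyticLogv T.K)).StarPacket v →
          Module.End ℚ ((logShellsDH (pilotDataOfK T.D T.K) (analyticLogv T.K)).StarPacket v))
      (Mmod : ℤ → ∀ j : (thetaIndex (pilotDataOfK T.D T.K)).LabelStar,
        Set ((logShellsDH (pilotDataOfK T.D T.K) (analyticLogv T.K)).GlobalPacket j.1))
      (region : ℤ → ∀ j : (thetaIndex (pilotDataOfK T.D T.K)).LabelStar, FinDivisor M →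
        ∀ vQ : (thetaIndex (pilotDataOfK T.D T.K)).VQ, Set ((logShellsDH (pilotDataOfK T.D T.K) (analyticLogv T.K)).Packet j.1 vQ))
      (n : ℤ) {HT : Type} {LogLink : HT → HT → Type} {IsFull : ∀ {s t : HT}, LogLink s t → Prop}
      (lat : LGPGaussianLogThetaLattice LogLink IsFull)
      {Frd : Type} {IsoF : Frd → Frd → Type} {Ob : Frd → Type} {realify : Frd → Frd} {Strip : Type}
      {IsoS : Strip → Strip → Type}
      {Mv : ∀ v : (thetaIndex (pilotDataOfK T.D T.K)).V, v ∈ (thetaIndex (pilotDataOfK T.D T.K)).Vbad → Type}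
      [∀ v h, Monoid (Mv v h)]
      (sig : GlobalLGPFrobenioidSignature (thetaIndex (pilotDataOfK T.D T.K)).lstar (thetaIndex (pilotDataOfK T.D T.K)).V
        (· ∈ (thetaIndex (pilotDataOfK T.D T.K)).Vbad) Frd IsoF Ob realify Strip IsoS Mv)
      (split : SplittingMonoids Mv) {ObΔ : Type}
      {N : ∀ v : (thetaIndex (pilotDataOfK T.D T.K)).V, v ∈ (thetaIndex (pilotDataOfK T.D T.K)).Vbad → Type} [∀ v h, Monoid (N v h)]
      (qData : QPilotData ObΔ N),
      offRemainder
          (settingPrVolSharp (pilotDataOfK T.D T.K) (logvAnalytic_analyticLogv (F := T.K)) M archPk archSub Ψ act Mmod region n lat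
            sig split qData (exists_realising_qIdeles_pilotDataOfK T.D).choose (exists_realising_thetaIdeles_pilotDataOfK T.D).choose
            (exists_realising_qIdeles_pilotDataOfK T.D).choose_spec.1 (exists_realising_qIdeles_pilotDataOfK T.D).choose_spec.2.1)
          (TameBandLicenceSigma.sigmaFive T.D) ≤
          ((l : ℝ) + 1) / 4 * (5 * ((((2 ^ 12 * 3 ^ 3 * 5 * Cor22.dmod P : ℕ) : ℝ)) * l)) →
      offRemainder
          (settingPrVolSharp (pilotDataOfK T.D T.K) (logvAnalytic_analyticLogv (F := T.K)) M archPk archSub Ψ act Mmod region n lat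
            sig split qData (exists_realising_qIdeles_pilotDataOfK T.D).choose (exists_realising_thetaIdeles_pilotDataOfK T.D).choose
            (exists_realising_qIdeles_pilotDataOfK T.D).choose_spec.1 (exists_realising_qIdeles_pilotDataOfK T.D).choose_spec.2.1)
          (TameBandLicenceSigmaBall.sigmaFiveBall T.D) ≤
          ((l : ℝ) + 1) / 4 * (5 * ((((2 ^ 12 * 3 ^ 3 * 5 * Cor22.dmod P : ℕ) : ℝ)) * l)) := by
  intro M _ _ archPk archSub Ψ act Mmod region n HT LogLink IsFull lat Frd IsoF Ob realify Strip IsoS Mv _ sig split ObΔ N _ qData hTolT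
  letI := T.instFieldF; letI := T.instNumberFieldF; letI := T.instAlgebraF; letI := T.instFieldK
  letI := T.instNumberFieldK; letI := T.instAlgebraK; letI := T.instFieldFbar; letI := T.instAlgebraFbar
  letI := T.instAlgebraKFbar; letI := T.instIsElliptic
  exact le_trans (TameBandLicenceSigmaBall.offRemainder_sigmaFiveBall_le_sigmaFive T.D (logvAnalytic_analyticLogv (F := T.K)) M archPk
    archSub Ψ act Mmod region n lat sig split qData _ _ _ _ (exists_realising_thetaIdeles_pilotDataOfK T.D).choose_spec.1
    (exists_realising_thetaIdeles_pilotDataOfK T.D).choose_spec.2.2) hTolT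

end Summit.ABC.IUTFork.Repair.RH.TameBandLicenceSigmaAbc

end
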